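import Summits.QuantumFields.YangMills.Theorems.BalabanUVNodesN15KingModelFreeKernelThermodynamicLimit
import Summits.QuantumFields.YangMills.Theorems.BalabanUVNodesN15KingModelFreeCovarianceDecay
import HarnessLib

/-!
# BalabanUVNodes ∕ N15 — THE KING-MODEL RUNG (PART Ε-g): THE FREE-BOUNDARY BOX COVARIANCE IN THE BULK IS THE INFINITE-VOLUME KERNEL —
# `|(c(−Δ_free)+m²)⁻¹_Ω(s,t) − K_∞(s−t)| ≤ (2∕m²)·[(2^{d+1}−1)C(κ_F)e^{−(κ_F∕(d+1))(2r+1)} + C(κ_F∕2)e^{−(κ_F∕2)(2r+1)}]` at depth `r`, and the FREE-b.c. THERMODYNAMIC LIMIT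
# `(boxOp (2N+1)^{d+1} c m²)⁻¹(z+N, N) → K_∞(z)` — the same limit as with periodic b.c. (part Ε-f): boundary conditions are invisible in the infinite volume
# (Track A, DAG node N15 = NE2; FAN-OUT v1.1 §N15 s3 «KING-MODEL RUNG», «torus-vs-box twin»; part Ν-c's bulk twin with its hypothesis discharged and completed by Ε-f; count-neutral)

HONEST FRAMING.  Count-neutral (cell `pub-ymgap`, seat `pub-ymgap-dag-n15-e` g40; `--supports stmt-QuantumFields-27366 --as helper` = K3⁸).
TEMPLATE LITERATURE: C. King, Commun. Math. Phys. **102** (1986) 649–677 [King1986], §4 p.670 l.8–13 (the Ω-propagators via the multiple reflection representation of [Ba 4]: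
«prove estimates on a lattice with periodic boundary conditions, and then carry over the results to Ω»), (4.4) p.670; [Balaban1983RegularityDecay] = [Ba 4] (2.42) p.584 (the image
series: the direct term `G_j(x,x′)` plus the reflected images); [Balaban1984PropagatorsI] p.36 l.20–23.  Part Ν-c (g39) proved the TORUS–BOX TWIN IN THE BULK under a torus decay
HYPOTHESIS `hB` (`kingBoxGreen_sub_direct_le_of_bulk`: the `2^{d+1} − 1` reflected images are far when `s, t` sit at depth `≥ r`); part Ε-d supplied `hB` (`lapF_inv_le_exp_tdistT`); part
Ε-f proved the TORUS–`ℤ^{d+1}` TWIN (`abs_lapF_inv_sub_freeKer_le`).  THIS FILE composes them: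
§1 ★★ **`kingBoxGreen_sub_direct_le`** — Ν-c's bulk twin UNCONDITIONALLY: `0 ≤ G^Ω(s,t) − B⁻¹_{T(2n)}(dbl s, dbl t) ≤ (2^{d+1}−1)(2∕m²)periodConst κ_F d·e^{−(κ_F∕(d+1))(2r+1)}`;
§2 ★ `centredDiff_dblBox` (on the doubled torus the centred representative of `dbl s − dbl t` is `s − t` itself: `|s_μ − t_μ| < n_μ`), ★★ **`abs_lapF_inv_dbl_sub_freeKer_le`** (the direct
term vs `K_∞(s−t)`: `≤ (2∕m²)periodConst(κ_F∕2) d·e^{−(κ_F∕4)·2L}` when all `n_μ ≥ L`); §3 ★★★ **`abs_boxOp_inv_sub_freeKer_le`** — THE BOX COVARIANCE IN THE BULK IS `K_∞`: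
for `s, t` at depth `≥ r` in every direction, `|(boxOp n c m²)⁻¹(s,t) − K_∞(s−t)| ≤ (2∕m²)[(2^{d+1}−1)·periodConst κ_F d·e^{−(κ_F∕(d+1))(2r+1)} + periodConst(κ_F∕2) d·e^{−(κ_F∕2)(2r+1)}]`
(boundary images + periodic wrap, both exponentially small in the depth); §4 ★★★ **`tendsto_boxOp_inv_bulk`** — THE FREE-b.c. THERMODYNAMIC LIMIT: on the cubes `{0,…,2N}^{d+1}`,
`(boxOp c m²)⁻¹(z + N·1, N·1) → K_∞(z)` as `N → ∞` for every `z ∈ ℤ^{d+1}` (`bulkPt`); with Ε-f's `tendsto_lapF_inv_cube` the periodic and the free limits COINCIDE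
(★ `tendsto_boxOp_inv_bulk_sub_lapF_inv_cube`: their difference tends to `0`).

PRIOR TREE ART (used, not restated): parts Ν-a′ (`boxOp_inv_eq_kingBoxGreen`), Ν-c (`kingBoxGreen_sub_direct_le_of_bulk`, `kingBoxGreen_sub_direct_nonneg`), Ε-c (`kingBoxZ`, `torRepZ_dblBox`),
Ε-d (`lapF_inv_le_exp_tdistT`, `periodConst_kappaFree_nonneg`), Ε-f (`centredDiff`, `centredDiff_centred`, `abs_lapF_inv_sub_freeKer_le`, `tendsto_lapF_inv_cube`), pv17 `B4TorusKernel`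
(`periodConst`, `translate`, `centreVec`).  NOT Bałaban's covariant objects; NOT a node discharge (N15 is booked through n15-a's knit, untouched); nothing continuum-YM ∕ `ℝ⁴` ∕ OS ∕ Clay.
0 `sorry`; 1 `def` (`bulkPt`).

HONEST SCOPE.  `c ≥ 0`, `m² > 0`, any `d`, any box; the depth rates are crude (`κ_F∕(d+1)` and `κ_F∕2` per site); the infinite-volume statement concerns the FREE scalar covariance only.
Locators: [King1986] §4 p.670 l.8–13, (4.4) p.670, (2.13) p.653; [Balaban1983RegularityDecay] (2.42) p.584; [Balaban1984PropagatorsI] p.36 l.20–23.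
-/

noncomputable section

open scoped BigOperators Topology
open Finset Complex Matrix Filter

namespace Summit.QuantumFields.YangMills.BalabanUVNodes.N15KingModelRung.TorusSpectral

open Literature.MathematicalPhysics.QuantumFieldTheory.Balaban1983to89.B5Prop11Plancherel (Tor unitVec)
open Literature.MathematicalPhysics.QuantumFieldTheory.Balaban1983to89.B4ContourShift (supNorm abs_le_supNorm supNorm_nonneg)
open Literature.MathematicalPhysics.QuantumFieldTheory.Balaban1983to89.B4TorusKernel (periodConst)
open Literature.MathematicalPhysics.QuantumFieldTheory.Balaban1983to89.B4TorusKernel.MultiPeriod (translate centreVec)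
open Literature.MathematicalPhysics.QuantumFieldTheory.King1986.Torus

variable {d : ℕ}

/-! ## §1 Part Ν-c's bulk twin, unconditionally -/

section Bulk

variable (n : Fin (d + 1) → ℕ) [hn : ∀ μ, NeZero (n μ)] {c m2 : ℝ}

/-- ★★ **THE TORUS–BOX TWIN IN THE BULK, UNCONDITIONALLY**: for `s, t` at depth `≥ r` in every direction of the box `Ω = Π_μ{0,…,n_μ−1}`,
`0 ≤ G^Ω(s,t) − B⁻¹_{T(2n)}(dbl s, dbl t) ≤ (2^{d+1} − 1)·(2∕m²)·periodConst κ_F d·e^{−(κ_F∕(d+1))·(2r+1)}` — the `2^{d+1} − 1` reflected images of [Ba 4] (2.42) are exponentially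
small in the depth (part Ν-c with part Ε-d's torus decay). [cite: King1986, §4 p.670 l.8–13; Balaban1983RegularityDecay, (2.42) p.584] -/
theorem kingBoxGreen_sub_direct_le (hc : 0 ≤ c) (hm : 0 < m2) (s t : KingBox n) {r : ℕ}
    (hbulk : ∀ μ, r ≤ (s μ).val ∧ r ≤ (t μ).val ∧ (s μ).val + r < n μ ∧ (t μ).val + r < n μ) :
    0 ≤ kingBoxGreen n c m2 s t - (lapF (dblPer n) c m2)⁻¹ (dblBox n s) (dblBox n t) ∧
      kingBoxGreen n c m2 s t - (lapF (dblPer n) c m2)⁻¹ (dblBox n s) (dblBox n t)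
        ≤ (2 ^ (d + 1) - 1) * (2 / m2 * periodConst (kappaFree c m2 d) d * Real.exp (-(kappaFree c m2 d / (d + 1) * (2 * r + 1)))) :=
  ⟨kingBoxGreen_sub_direct_nonneg n hc hm s t,
    kingBoxGreen_sub_direct_le_of_bulk n (periodConst_kappaFree_nonneg hc hm) (div_nonneg (kappaFree_pos hc hm d).le (by positivity))
      (fun w w' => lapF_inv_le_exp_tdistT (dblPer n) hc hm w w') s t hbulk⟩

end Bulk

/-! ## §2 The direct term of the doubled torus vs the infinite-volume kernel -/

section Direct

variable (n : Fin (d + 1) → ℕ) [hn : ∀ μ, NeZero (n μ)] {c m2 : ℝ}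

/-- ★ On the doubled torus the centred representative of `dbl s − dbl t` is `s − t` itself (`|s_μ − t_μ| ≤ n_μ − 1 < n_μ`; congruent centred vectors closer than the period agree).
[folklore] -/
theorem centredDiff_dblBox (s t : KingBox n) : centredDiff (dblPer n) (dblBox n s) (dblBox n t) = kingBoxZ n s - kingBoxZ n t := by
  have hcen := centredDiff_centred (dblPer n) (dblBox n s) (dblBox n t)
  funext i
  have hc := hcen i
  -- `w₀ = (s − t) + 2n·c` coordinatewise
  have hw : centredDiff (dblPer n) (dblBox n s) (dblBox n t) i
      = (kingBoxZ n s - kingBoxZ n t) i + ((2 * n i : ℕ) : ℤ) * centreVec (dblPer n) (torRepZ (dblPer n) (dblBox n s) - torRepZ (dblPer n) (dblBox n t)) i := by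
    unfold centredDiff
    rw [Literature.MathematicalPhysics.QuantumFieldTheory.Balaban1983to89.B4TorusKernel.MultiPeriod.translate_apply, torRepZ_dblBox, torRepZ_dblBox]
  set k := centreVec (dblPer n) (torRepZ (dblPer n) (dblBox n s) - torRepZ (dblPer n) (dblBox n t)) i with hk
  have hs : (kingBoxZ n s i : ℤ) < n i := by unfold kingBoxZ; exact_mod_cast (s i).isLt
  have ht : (kingBoxZ n t i : ℤ) < n i := by unfold kingBoxZ; exact_mod_cast (t i).isLt
  have hs0 : 0 ≤ kingBoxZ n s i := by unfold kingBoxZ; positivity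
  have ht0 : 0 ≤ kingBoxZ n t i := by unfold kingBoxZ; positivity
  have hc' : 2 * |(kingBoxZ n s - kingBoxZ n t) i + ((2 * n i : ℕ) : ℤ) * k| ≤ ((2 * n i : ℕ) : ℤ) := by rw [← hw]; exact_mod_cast hc
  rw [Pi.sub_apply] at hc' ⊢
  push_cast at hc'
  have hk0 : k = 0 := by
    rcases lt_trichotomy k 0 with hneg | h0 | hpos
    · exfalso
      have : k ≤ -1 := by omega
      have h1 := (abs_le.mp (by linarith [hc'] : |kingBoxZ n s i - kingBoxZ n t i + 2 * (n i : ℤ) * k| ≤ (n i : ℤ))).1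
      nlinarith
    · exact h0
    · exfalso
      have : 1 ≤ k := by omega
      have h1 := (abs_le.mp (by linarith [hc'] : |kingBoxZ n s i - kingBoxZ n t i + 2 * (n i : ℤ) * k| ≤ (n i : ℤ))).2
      nlinarith
  rw [hw, Pi.sub_apply, hk0, mul_zero, add_zero]

/-- ★★ **THE DIRECT TERM vs `K_∞`**: `|B⁻¹_{T(2n)}(dbl s, dbl t) − K_∞(s − t)| ≤ (2∕m²)·periodConst(κ_F∕2) d·e^{−(κ_F∕4)·(2L)}` whenever all `n_μ ≥ L` (part Ε-f on the doubled torus, whose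
periods are `2n_μ ≥ 2L`). [cite: Balaban1984PropagatorsI, p.36 l.20–23; King1986, (4.4) p.670] -/
theorem abs_lapF_inv_dbl_sub_freeKer_le (hc : 0 ≤ c) (hm : 0 < m2) {L : ℕ} (hL : ∀ i, L ≤ n i) (s t : KingBox n) :
    |(lapF (dblPer n) c m2)⁻¹ (dblBox n s) (dblBox n t) - freeKer c m2 (kingBoxZ n s - kingBoxZ n t)|
      ≤ 2 / m2 * periodConst (kappaFree c m2 d / 2) d * Real.exp (-(kappaFree c m2 d / 4 * ((2 * L : ℕ) : ℝ))) := by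
  have h := abs_lapF_inv_sub_freeKer_le (dblPer n) hc hm (L := 2 * L) (fun i => Nat.mul_le_mul_left 2 (hL i)) (dblBox n s) (dblBox n t)
  rwa [centredDiff_dblBox] at h

end Direct

/-! ## §3 The free-boundary box covariance in the bulk is the infinite-volume kernel -/

section BoxVsLattice

variable (n : Fin (d + 1) → ℕ) [hn : ∀ μ, NeZero (n μ)] {c m2 : ℝ}

/-- ★★★ **THE BOX COVARIANCE IN THE BULK IS `K_∞`**: for `s, t` at depth `≥ r` in every direction of `Ω = Π_μ{0,…,n_μ−1}` (`c ≥ 0`, `m² > 0`),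
`|(c(−Δ_free)+m²)⁻¹_Ω(s,t) − K_∞(s−t)| ≤ (2∕m²)·[(2^{d+1}−1)·periodConst κ_F d·e^{−(κ_F∕(d+1))(2r+1)} + periodConst(κ_F∕2) d·e^{−(κ_F∕4)·2(2r+1)}]` — the reflected images (boundary)
and the periodic wrap (volume) are both exponentially small in the depth. [cite: King1986, §4 p.670 l.8–13, (2.13) p.653; Balaban1983RegularityDecay, (2.42) p.584; Balaban1984PropagatorsI, p.36 l.20–23] -/
theorem abs_boxOp_inv_sub_freeKer_le (hc : 0 ≤ c) (hm : 0 < m2) (s t : KingBox n) {r : ℕ}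
    (hbulk : ∀ μ, r ≤ (s μ).val ∧ r ≤ (t μ).val ∧ (s μ).val + r < n μ ∧ (t μ).val + r < n μ) :
    |(boxOp n c m2)⁻¹ s t - freeKer c m2 (kingBoxZ n s - kingBoxZ n t)|
      ≤ 2 / m2 * ((2 ^ (d + 1) - 1) * periodConst (kappaFree c m2 d) d * Real.exp (-(kappaFree c m2 d / (d + 1) * (2 * r + 1)))
          + periodConst (kappaFree c m2 d / 2) d * Real.exp (-(kappaFree c m2 d / 4 * ((2 * (2 * r + 1) : ℕ) : ℝ)))) := by
  have hL : ∀ i, 2 * r + 1 ≤ n i := fun i => by have := hbulk i; omega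
  obtain ⟨h0, h1⟩ := kingBoxGreen_sub_direct_le n hc hm s t hbulk
  have h2 := abs_lapF_inv_dbl_sub_freeKer_le n hc hm hL s t
  rw [boxOp_inv_eq_kingBoxGreen n hc hm]
  have htri : |kingBoxGreen n c m2 s t - freeKer c m2 (kingBoxZ n s - kingBoxZ n t)|
      ≤ |kingBoxGreen n c m2 s t - (lapF (dblPer n) c m2)⁻¹ (dblBox n s) (dblBox n t)|
        + |(lapF (dblPer n) c m2)⁻¹ (dblBox n s) (dblBox n t) - freeKer c m2 (kingBoxZ n s - kingBoxZ n t)| := by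
    have := abs_sub_le (kingBoxGreen n c m2 s t) ((lapF (dblPer n) c m2)⁻¹ (dblBox n s) (dblBox n t)) (freeKer c m2 (kingBoxZ n s - kingBoxZ n t))
    exact this
  rw [abs_of_nonneg h0] at htri
  calc |kingBoxGreen n c m2 s t - freeKer c m2 (kingBoxZ n s - kingBoxZ n t)|
      ≤ (2 ^ (d + 1) - 1) * (2 / m2 * periodConst (kappaFree c m2 d) d * Real.exp (-(kappaFree c m2 d / (d + 1) * (2 * r + 1))))
        + 2 / m2 * periodConst (kappaFree c m2 d / 2) d * Real.exp (-(kappaFree c m2 d / 4 * ((2 * (2 * r + 1) : ℕ) : ℝ))) :=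
          le_trans htri (add_le_add h1 h2)
    _ = _ := by ring

end BoxVsLattice

/-! ## §4 The thermodynamic limit with free boundary conditions -/

section Limit

variable {c m2 : ℝ}

/-- The site `z ∈ ℤ^{d+1}` shifted to the centre of the cube `{0,…,2N}^{d+1}`: coordinates `z_μ + N` (reduced `mod (2N+1)` to be total; equal to `z_μ + N` once `|z|_∞ ≤ N`).
[folklore] -/
def bulkPt (N : ℕ) (z : Fin (d + 1) → ℤ) : KingBox (fun _ : Fin (d + 1) => 2 * N + 1) :=
  fun μ => ⟨(z μ + N).toNat % (2 * N + 1), Nat.mod_lt _ (Nat.succ_pos _)⟩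

/-- in the bulk (`|z|_∞ ≤ N`) the coordinates of `bulkPt N z` are `z_μ + N`. [folklore] -/
theorem kingBoxZ_bulkPt {N : ℕ} {z : Fin (d + 1) → ℤ} (hz : ∀ i, |z i| ≤ N) (i : Fin (d + 1)) :
    kingBoxZ (fun _ : Fin (d + 1) => 2 * N + 1) (bulkPt N z) i = z i + N := by
  have h1 := abs_le.mp (hz i)
  have h0 : 0 ≤ z i + N := by linarith [h1.1]
  have hlt : (z i + N).toNat < 2 * N + 1 := by
    have : ((z i + N).toNat : ℤ) = z i + N := Int.toNat_of_nonneg h0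
    omega
  unfold kingBoxZ bulkPt
  simp only []
  rw [Nat.mod_eq_of_lt hlt]
  exact Int.toNat_of_nonneg h0

/-- ★★★ **THE FREE-BOUNDARY THERMODYNAMIC LIMIT OF KING's BOX COVARIANCE**: for every `z ∈ ℤ^{d+1}`, `c ≥ 0`, `m² > 0`, on the cubes `{0,…,2N}^{d+1}` with free boundary conditions,
`(boxOp c m²)⁻¹(z + N·1, N·1) → K_∞(z)` as `N → ∞` — the same infinite-volume kernel as with periodic boundary conditions (part Ε-f `tendsto_lapF_inv_cube`).
[cite: King1986, §4 p.670 l.8–13, (2.13) p.653; Balaban1983RegularityDecay, (2.42) p.584] -/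
theorem tendsto_boxOp_inv_bulk (hc : 0 ≤ c) (hm : 0 < m2) (z : Fin (d + 1) → ℤ) :
    Tendsto (fun N : ℕ => (boxOp (fun _ : Fin (d + 1) => 2 * N + 1) c m2)⁻¹ (bulkPt N z) (bulkPt N 0)) atTop (𝓝 (freeKer c m2 z)) := by
  set κ := kappaFree c m2 d with hκdef
  have hκ : 0 < κ := kappaFree_pos hc hm d
  set A := 2 / m2 * ((2 ^ (d + 1) - 1) * periodConst κ d) with hA
  set B := 2 / m2 * periodConst (κ / 2) d with hB
  -- the error bound, eventually: depth `r = N − ⌈|z|_∞⌉`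
  set R : ℕ := ⌈supNorm z⌉₊ with hR
  have hzR : ∀ i, |z i| ≤ (R : ℤ) := by
    intro i
    have h1 : ((|z i| : ℤ) : ℝ) ≤ supNorm z := abs_le_supNorm z i
    have h2 : supNorm z ≤ (R : ℝ) := Nat.le_ceil _
    exact_mod_cast h1.trans h2
  have hev : ∀ᶠ N : ℕ in atTop, |(boxOp (fun _ : Fin (d + 1) => 2 * N + 1) c m2)⁻¹ (bulkPt N z) (bulkPt N 0) - freeKer c m2 z|
      ≤ A * Real.exp (-(κ / (d + 1) * (2 * ((N - R : ℕ) : ℝ) + 1))) + B * Real.exp (-(κ / 4 * (2 * (2 * ((N - R : ℕ) : ℝ) + 1)))) := by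
    refine Filter.eventually_atTop.2 ⟨R, fun N hN => ?_⟩
    have hzN : ∀ i, |z i| ≤ (N : ℤ) := fun i => (hzR i).trans (by exact_mod_cast hN)
    have hz0 : ∀ i, |(0 : Fin (d + 1) → ℤ) i| ≤ (N : ℤ) := fun i => by simp
    have hdiff : kingBoxZ (fun _ : Fin (d + 1) => 2 * N + 1) (bulkPt N z) - kingBoxZ (fun _ : Fin (d + 1) => 2 * N + 1) (bulkPt N 0) = z := by
      funext i; rw [Pi.sub_apply, kingBoxZ_bulkPt hzN, kingBoxZ_bulkPt hz0]; simp
    have hbulk : ∀ μ : Fin (d + 1), N - R ≤ ((bulkPt N z) μ).val ∧ N - R ≤ ((bulkPt N 0) μ).val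
        ∧ ((bulkPt N z) μ).val + (N - R) < 2 * N + 1 ∧ ((bulkPt N 0) μ).val + (N - R) < 2 * N + 1 := by
      intro μ
      have e1 : ((((bulkPt N z) μ).val : ℕ) : ℤ) = z μ + N := kingBoxZ_bulkPt hzN μ
      have e2 : ((((bulkPt N (0 : Fin (d + 1) → ℤ)) μ).val : ℕ) : ℤ) = (0 : Fin (d + 1) → ℤ) μ + N := kingBoxZ_bulkPt hz0 μ
      rw [Pi.zero_apply] at e2
      have h1 := abs_le.mp (hzR μ)
      have hRN : (((N - R : ℕ) : ℤ)) = (N : ℤ) - R := by omega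
      refine ⟨?_, ?_, ?_, ?_⟩ <;> omega
    have h := abs_boxOp_inv_sub_freeKer_le (fun _ : Fin (d + 1) => 2 * N + 1) hc hm (bulkPt N z) (bulkPt N 0) hbulk
    rw [hdiff] at h
    refine le_trans h (le_of_eq ?_)
    rw [hA, hB]
    push_cast
    ring
  -- both error terms tend to zero
  have hNR : Tendsto (fun N : ℕ => ((N - R : ℕ) : ℝ)) atTop atTop :=
    tendsto_natCast_atTop_atTop.comp (tendsto_sub_atTop_nat R)
  have hlimA : Tendsto (fun N : ℕ => A * Real.exp (-(κ / (d + 1) * (2 * ((N - R : ℕ) : ℝ) + 1)))) atTop (𝓝 0) := by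
    rw [show (0 : ℝ) = A * 0 by ring]
    refine Tendsto.const_mul A (Real.tendsto_exp_atBot.comp (tendsto_neg_atTop_atBot.comp ?_))
    refine Tendsto.const_mul_atTop (by positivity) ?_
    exact tendsto_atTop_add_const_right _ 1 (Tendsto.const_mul_atTop two_pos hNR)
  have hlimB : Tendsto (fun N : ℕ => B * Real.exp (-(κ / 4 * (2 * (2 * ((N - R : ℕ) : ℝ) + 1))))) atTop (𝓝 0) := by
    rw [show (0 : ℝ) = B * 0 by ring]
    refine Tendsto.const_mul B (Real.tendsto_exp_atBot.comp (tendsto_neg_atTop_atBot.comp ?_))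
    refine Tendsto.const_mul_atTop (by positivity) (Tendsto.const_mul_atTop two_pos ?_)
    exact tendsto_atTop_add_const_right _ 1 (Tendsto.const_mul_atTop two_pos hNR)
  rw [tendsto_iff_norm_sub_tendsto_zero]
  refine squeeze_zero' (Filter.Eventually.of_forall fun N => norm_nonneg _) ?_ (by simpa using hlimA.add hlimB)
  filter_upwards [hev] with N hN
  rwa [Real.norm_eq_abs]

/-- ★ **BOUNDARY CONDITIONS ARE INVISIBLE IN THE INFINITE VOLUME**: the free-boundary bulk values and the periodic values of King's free covariance have the same limit `K_∞(z)`;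
their difference tends to `0`. [cite: King1986, §4 p.670 l.8–13] -/
theorem tendsto_boxOp_inv_bulk_sub_lapF_inv_cube (hc : 0 ≤ c) (hm : 0 < m2) (z : Fin (d + 1) → ℤ) :
    Tendsto (fun N : ℕ => (boxOp (fun _ : Fin (d + 1) => 2 * N + 1) c m2)⁻¹ (bulkPt N z) (bulkPt N 0)
      - (lapF (fun _ : Fin (d + 1) => N + 1) c m2)⁻¹ (cubePt N z) 0) atTop (𝓝 0) := by
  have h := (tendsto_boxOp_inv_bulk (d := d) hc hm z).sub (tendsto_lapF_inv_cube (d := d) hc hm z)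
  rwa [sub_self] at h

end Limit

end Summit.QuantumFields.YangMills.BalabanUVNodes.N15KingModelRung.TorusSpectral

end
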